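import Summits.MatrixMultiplication.OmegaCensus.DominoZpZpCells
import Summits.MatrixMultiplication.OmegaCensus.DominoZ13StructSevenExcl
import Summits.MatrixMultiplication.OmegaCensus.DominoZ13StructSevenRows1
import Summits.MatrixMultiplication.OmegaCensus.DominoZ13StructSevenRows2
import Summits.MatrixMultiplication.OmegaCensus.DominoZ13StructSevenRows3
import Summits.MatrixMultiplication.OmegaCensus.DominoZ13StructSevenRows4
import Summits.MatrixMultiplication.OmegaCensus.DominoZ13StructSevenRows5
import Summits.MatrixMultiplication.OmegaCensus.DominoZ13StructSevenRows6
import Summits.MatrixMultiplication.OmegaCensus.DominoZ13StructSevenPairsA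
import Summits.MatrixMultiplication.OmegaCensus.DominoZ13StructSevenPairsB
import Summits.MatrixMultiplication.OmegaCensus.DominoZ13Z13Cells
import HarnessLib

/-!
# No domino cube law with a part of size `7` over any `A ↠ ℤ_13 × ℤ_13` (structural route)

ω-census `pub-omega`, family (b3), seat pub-omega-group gen 24.  Framing: lottery ticket; floor = certified bounds/negative
ranges.  VALUE: per-prime kernel data of the STRUCTURAL part-`7` route (`DominoZpZpStructSeven*.lean`) for `p = 13` —
target: the OPEN census cell `(1,7,8)@169` (`A = ℤ₁₃²`) and every larger order with a quotient `ℤ₁₃²`; NOT progress on ω.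

Assembly: rows `12`–`12` of the completeness check, `checkSevenRest`, `checkSeven_13`, and (with the chunked excluded-list
decides of `DominoZ13StructSevenExcl.lean`)
`exists_entry_structSeven_of_checks` with the decides of `DominoZ13StructSevenData/Rows*/PairsA/PairsB.lean`; cells
`no_law_cube_17e_of_onto_z13z13` / `no_law_cube_1d7_of_onto_z13z13` = no `(1,1 | 7,7 | e,e)` law triple, either order, any `e`,
in any dihedral-like group (any `c₀`) over ANY finite abelian `A ↠ ℤ_13 × ℤ_13` — census cell `(1,7,8)@169`.
-/

namespace Summit.MatrixMultiplication.OmegaCensus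

open Finset ZpZpDomino Literature.Combinatorics.Additive

namespace ZpZpDomino

set_option maxHeartbeats 4000000 in
/-- Row `b = 12`, columns `0`–`4` (`5·13³` lookups). [folklore] -/
theorem checkSevenRowCols_13_12_1 : checkSevenRowCols 13 etZ13s7 tabTreeZ13s7 12 0 5 = true := by decide +kernel
set_option maxHeartbeats 4000000 in
/-- Row `b = 12`, columns `5`–`8` (`4·13³` lookups). [folklore] -/
theorem checkSevenRowCols_13_12_2 : checkSevenRowCols 13 etZ13s7 tabTreeZ13s7 12 5 4 = true := by decide +kernel
set_option maxHeartbeats 4000000 in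
/-- Row `b = 12`, columns `9`–`12` (`4·13³` lookups). [folklore] -/
theorem checkSevenRowCols_13_12_3 : checkSevenRowCols 13 etZ13s7 tabTreeZ13s7 12 9 4 = true := by decide +kernel
/-- Row `b = 12` of the completeness check, assembled from its column chunks. [folklore] -/
theorem checkSevenRow_13_12 : checkSevenRow 13 etZ13s7 tabTreeZ13s7 12 = true :=
  checkSevenRow_of_cols3 (by decide : 5 + 4 = 9) (by decide : 9 + 4 = 13) checkSevenRowCols_13_12_1 checkSevenRowCols_13_12_2 checkSevenRowCols_13_12_3

set_option maxHeartbeats 4000000 in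
/-- Rest family `(0,0,1,c,…)`, columns `0`–`4`. [folklore] -/
theorem checkSevenRestCols_13_1 : checkSevenRestCols 13 etZ13s7 tabTreeZ13s7 0 5 = true := by decide +kernel
set_option maxHeartbeats 4000000 in
/-- Rest family `(0,0,1,c,…)`, columns `5`–`8`. [folklore] -/
theorem checkSevenRestCols_13_2 : checkSevenRestCols 13 etZ13s7 tabTreeZ13s7 5 4 = true := by decide +kernel
set_option maxHeartbeats 4000000 in
/-- Rest family `(0,0,1,c,…)`, columns `9`–`12`. [folklore] -/
theorem checkSevenRestCols_13_3 : checkSevenRestCols 13 etZ13s7 tabTreeZ13s7 9 4 = true := by decide +kernel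
set_option maxHeartbeats 4000000 in
/-- The small rest families. [folklore] -/
theorem checkSevenRestSmall_13 : checkSevenRestSmall 13 etZ13s7 tabTreeZ13s7 = true := by decide +kernel
/-- The remaining normalised tuples, assembled. [folklore] -/
theorem checkSevenRest_13 : checkSevenRest 13 etZ13s7 tabTreeZ13s7 = true :=
  checkSevenRest_of_cols3 (by decide : 5 + 4 = 9) (by decide : 9 + 4 = 13)
    checkSevenRestCols_13_1 checkSevenRestCols_13_2 checkSevenRestCols_13_3 checkSevenRestSmall_13

/-- **Completeness** (rows assembled). [folklore] -/
theorem checkSeven_13 : checkSeven 13 etZ13s7 tabTreeZ13s7 = true := by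
  refine checkSeven_of_rows (fun b hb => ?_) checkSevenRest_13
  interval_cases b
  exacts [checkSevenRow_13_0, checkSevenRow_13_1, checkSevenRow_13_2, checkSevenRow_13_3, checkSevenRow_13_4, checkSevenRow_13_5, checkSevenRow_13_6, checkSevenRow_13_7, checkSevenRow_13_8, checkSevenRow_13_9, checkSevenRow_13_10, checkSevenRow_13_11, checkSevenRow_13_12]

/-- **Every value function of sum `7` on `ZMod 13 × ZMod 13` has a line direction whose count vector is, up to a unit scaling,
a certified entry of `tableZ13s7`** (structural part-`7` route). [folklore] -/
theorem exists_table_entry_13_7s (g : Fin (13 * 13) → ℕ) (hg : ∑ i, g i = 7)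
    (_hNF : (1 ≤ g ⟨13, by decide⟩ ∧ 1 ≤ g ⟨1, by decide⟩) ∨
      (1 ≤ g ⟨13, by decide⟩ ∧ ∀ i : Fin (13 * 13), i.val % 13 ≠ 0 → g i = 0) ∨ (∀ i : Fin (13 * 13), i.val ≠ 0 → g i = 0)) :
    ∃ j < 13 + 1, ∃ k : ℕ, k % 13 ≠ 0 ∧ ∃ e ∈ tableZ13s7, ∀ v < 13,
      e.1.getD (k * v % 13) 0 = ∑ i : Fin (13 * 13), pick v (pv 13 j i.val) (g i) :=
  haveI : Fact (Nat.Prime 13) := ⟨by decide⟩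
  exists_entry_structSeven_of_checks (by decide) eZ13s7 rZ13s7 2 etZ13s7 checkE1seven_13
    (checkE2g_of_checkE2gt checkEwf7_13 etZ13s7_sound checkE2gt7_13) checkR7_13
    etZ13s7_complete checkH7a_13 checkH7b_13 tableZ13s7 tabTreeZ13s7 (fun _ h => mem_tabTree h) tableZ13s7_wf checkEwf7_13
    etZ13s7_sound checkSeven_13 g hg

end ZpZpDomino

variable {A : Type} [AddCommGroup A] [DecidableEq A] [Fintype A] {G : Type} [Group G] [DecidableEq G]
  {ρ τ : A → G} {c₀ : A} {S T U : Finset G}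

/-- **No `(1,1 | 7,7 | e,e)` law triple over `A ↠ ℤ_13 × ℤ_13`** (dihedral-like `G`, any `c₀`, `φ` onto). [folklore] -/
theorem no_law_cube_17e_of_onto_z13z13
    (hρρ : ∀ a b, ρ a * ρ b = ρ (a + b)) (hρτ : ∀ a b, ρ a * τ b = τ (b - a))
    (hτρ : ∀ a b, τ a * ρ b = τ (a + b)) (hττ : ∀ a b, τ a * τ b = ρ (c₀ + b - a))
    (hρ : Function.Injective ρ) (hτ : Function.Injective τ) (hne : ∀ a b, ρ a ≠ τ b)
    (hsurj : ∀ g, (∃ a, ρ a = g) ∨ (∃ a, τ a = g))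
    (φ : A →+ ZMod 13 × ZMod 13) (hφ : Function.Surjective φ)
    (h : TripleProductProperty S T U)
    (hS₀ : (univ.filter fun a : A => ρ a ∈ S).card = 1) (hS₁ : (univ.filter fun a : A => τ a ∈ S).card = 1)
    (hT₀ : (univ.filter fun a : A => ρ a ∈ T).card = 7) (hT₁ : (univ.filter fun a : A => τ a ∈ T).card = 7)
    (hU : (univ.filter fun a : A => ρ a ∈ U).card = (univ.filter fun a : A => τ a ∈ U).card)
    (hV : 3 * (S.card * T.card * U.card) + 8 = 8 * Fintype.card A) : False :=
  haveI : Fact (Nat.Prime 13) := ⟨by decide⟩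
  no_law_cube_1de_of_onto_zpzp_of_cover (7 : ZMod 13) half_zmod13 tableZ13s7 tableZ13s7_cert ⟨13, by decide⟩ ⟨1, by decide⟩
    rfl rfl exists_table_entry_13_7s hρρ hρτ hτρ hττ hρ hτ hne hsurj φ hφ h hS₀ hS₁ hT₀ hT₁ hU hV

/-- **No `(1,1 | d,d | 7,7)` law triple over `A ↠ ℤ_13 × ℤ_13`** (dihedral-like `G`, any `c₀`, `φ` onto). [folklore] -/
theorem no_law_cube_1d7_of_onto_z13z13
    (hρρ : ∀ a b, ρ a * ρ b = ρ (a + b)) (hρτ : ∀ a b, ρ a * τ b = τ (b - a))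
    (hτρ : ∀ a b, τ a * ρ b = τ (a + b)) (hττ : ∀ a b, τ a * τ b = ρ (c₀ + b - a))
    (hρ : Function.Injective ρ) (hτ : Function.Injective τ) (hne : ∀ a b, ρ a ≠ τ b)
    (hsurj : ∀ g, (∃ a, ρ a = g) ∨ (∃ a, τ a = g))
    (φ : A →+ ZMod 13 × ZMod 13) (hφ : Function.Surjective φ)
    (h : TripleProductProperty S T U)
    (hS₀ : (univ.filter fun a : A => ρ a ∈ S).card = 1) (hS₁ : (univ.filter fun a : A => τ a ∈ S).card = 1)
    (hT : (univ.filter fun a : A => ρ a ∈ T).card = (univ.filter fun a : A => τ a ∈ T).card)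
    (hU₀ : (univ.filter fun a : A => ρ a ∈ U).card = 7) (hU₁ : (univ.filter fun a : A => τ a ∈ U).card = 7)
    (hV : 3 * (S.card * T.card * U.card) + 8 = 8 * Fintype.card A) : False :=
  haveI : Fact (Nat.Prime 13) := ⟨by decide⟩
  no_law_cube_1d_e_of_onto_zpzp_of_cover (7 : ZMod 13) half_zmod13 tableZ13s7 tableZ13s7_cert ⟨13, by decide⟩ ⟨1, by decide⟩
    rfl rfl exists_table_entry_13_7s hρρ hρτ hτρ hττ hρ hτ hne hsurj φ hφ h hS₀ hS₁ hT hU₀ hU₁ hV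

end Summit.MatrixMultiplication.OmegaCensus
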